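import Literature.MathematicalPhysics.QuantumFieldTheory.Balaban1983to89.T4DressedR

/-!
# T4FibreTranslate — a fibrewise right-Haar translation commutes with Bałaban's fibre integrals: the change of variables
# `V′_k = V_k(V_Λ)⁻¹` of (1.100) [IV] / p. 378 [V] as a kernel identity over `Setup.fieldMeasure`
# (cell `pub-balaban`, lineage b01, row T4-U5.X-15-K*; kernel companion of `t4/T4-XREAD-U5X15.md` §2 C13/C14 + §3 L9; bookkeeping)

HONEST FRAMING (cell `pub-balaban`, T4-DAG v3).  The cell's T4 target is the existence AND uniqueness of the continuum
limit of Bałaban's unit-scale averaged loop expectations on a finite torus — NOT the Yang–Mills mass gap, NOT the Clay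
problem.  This module is the kernel companion of ONE located item of the cross-reading `t4/T4-XREAD-U5X15.md` (row
T4-U5.X-15 of `t4/T4-DAG.md` v3; census rows C13/C14 of its §2 Table C and item L9 of its §3): in the basic large-field
operation (1.100) of [Balaban1989LargeFieldI] = [IV] the numerator is evaluated at the field `V′_k`, which [IV] does not
define and [Balaban1989LargeFieldII] = [V] p. 378 defines as «V′_k = V_k(V_Λ)^{−1}», while the denominator integrates
`dV′⌈_{Λ_i}` over the translated variable.  What is proved here is ELEMENTARY MEASURE THEORY and nothing else: a finite
product of right-invariant measures is invariant under a translation of the integrated (fibre) variables by a field that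
does not depend on them; hence the printed `dV′⌈_{Λ_i}`-denominator EQUALS the fibre integral, over the LITERAL
`Λ_i`-variables of `V_k`, of the numerator read as a function of `V_k` (C13: `V′_kV_{Λ_i} = V_k`), so that the `i`-th
quotient of (1.100) times the integrated old expression is ONE `B15.BasicStep.normTerm` and its normalization (1.102) is
`B15.BasicStep.integral_normTerm_eq` BY NAME.  The translating field is an ARBITRARY field functional `vΛ` carrying the
HYPOTHESIS SHAPE `FieldIndep s vΛ` ("does not depend on the integrated variables") — the shape the text gives Bałaban's
`V_Λ` (p. 194: the minimum of the Wilson action «on the domain of integration», i.e. over the `Λ`-variables, hence a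
functional of the remaining ones; p. 197: «The configuration M^k(U₀) = V_Λ»); it is NOT asserted here that Bałaban's
minimiser exists, is unique, measurable, or has any printed property — those are [IV] (1.78)/(1.83) and the B12-side
inputs of the cell's DAG (U1a), untouched.  No estimate of the papers is used or certified.  Value = kernel certificate of
a bookkeeping identity (change of variables), NOT summit progress.

CITATION HEADER (lean-in-tree rule 2026-08-18).  T. Bałaban, *Large field renormalization. I. The basic step of the 𝐑
operation*, Comm. Math. Phys. **122**, 175–202 (1989) [Balaban1989LargeFieldI] (cell paper B15 = [IV]; PDF held
`paper:balaban1989-cmp122-large-field-i`, journal page = PDF page + 174); T. Bałaban, *Large field renormalization. II.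
Localization, exponentiation, and bounds for the 𝐑 operation*, Comm. Math. Phys. **122**, 355–392 (1989)
[Balaban1989LargeFieldII] (cell paper B16 = [V]).  Both are manuscripts UNDER ADJUDICATION by the audit cell; they are
quoted below for the SHAPE of their formulas only (quotations «…» transcribed from the page renders in
`t4/T4-XREAD-U5X15.md` §1 and `t4/T4-XREAD-O3X1.md`), never as facts.

WHAT IS PRINTED.
* [IV] (1.100) p. 201, the factor of the `i`-th renormalized component `Λ_i ⊂ X_i`:
  «δ_{G_i}(V′_k)χ(Λ_i) exp[−(1/g_k²) A(ζ_i, U_{k,X_i}(V′_kV_{Λ_i}))] / ∫dV′⌈_{Λ_i} δ_{G_i}(V′)χ(Λ_i) exp[−(1/g_k²) A(ζ_i,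
  U_{k,X_i}(V′V_{Λ_i}))] · ∫dV_h⌈_{(Ω″^{~2}_{i,h+1})^c} χ_{h,1/2}((Ω″^~_{i,h+1})^c∩Ω_{i,h}) 𝕋_h(Z_{i,h}) ∫dV′⌈_{𝔹_i}
  δ_{T_i}(V′) χ′_i», with (1.101) «χ(Λ_i) = χ({|(1/i) log V′(b)| < M₀ε_k for b∈Λ_i})» and (1.102) «The above operation
  has the fundamental normalization property ∫dV_k(ℝ′ρ_k)(V_k) = ∫dV_kρ_k(V_k).»
* [V] p. 378: «These bounds and the axial gauge conditions for V′_k = V_k(V_Λ)^{−1} imply the bound (1.83) [IV] for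
  V′_k».  (The only printed definition of `V′_k`; [IV] has the parallel construction «V″ = V′V₀ on Λ₀» (1.81) p. 195.)
* [IV] p. 194 (the Λ-integration step): «We obtain a new expression, which we consider as a function of all field
  variables V_k, but independent of V_k⌈_Λ.»; p. 194 after (1.76): «we should find a minimum of the Wilson action
  A(U″_k) on the domain of integration»; p. 197: «The configuration M^k(U₀) = V_Λ satisfies the regularity condition
  (1.78). We fix for it the axial gauge in Λ^{(k)}».
* [IV] p. 176: the fibre measures are the normalized Haar measures of the bond variables, (0.3)/(0.4) (typed in
  `B15.BasicStep`: `fibreIntegral s f V` = `∫dV⌈_s f` as a function of the whole field, `normTerm`, `integral_normTerm_eq`).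

DICTIONARY.  `s : Finset (PBond P j)` = the bond variables of `Λ_i` (the fibre); `V : GaugeField P j G` = `V_k`;
`translateOn s U W` = the field `U·W` on the bonds of `s`, `U` elsewhere (bondwise right multiplication in `G`);
`vΛ : GaugeField → GaugeField` = the translating field `V_{Λ_i}` as a functional of the whole field, `FieldIndep s vΛ` =
it does not depend on the `s`-variables; `F : Density P j G` = the numerator of the `i`-th quotient READ AS A FUNCTION OF
`V_k`, i.e. `F(V) := [δ_{G_i}χ(Λ_i)](V⌈_{Λ_i}·(V_{Λ_i})⁻¹) · exp[−g_k^{−2}A(ζ_i, U_{k,X_i}(V))]` (C13: `V′_kV_{Λ_i} = V_k`);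
then, reading [R]: at `U = (V′ on Λ_i, V_k elsewhere)` the value `F(translateOn s U (vΛ U))` is literally the printed
denominator integrand `δ_{G_i}(V′)χ(Λ_i) exp[−g_k^{−2}A(ζ_i, U_{k,X_i}(V′V_{Λ_i}))]` (the factors `δ_{G_i}χ(Λ_i)` read
only the `Λ_i`-coordinates; the exterior variables are completed by `V_k`, as in the numerator), so the printed
denominator is `fibreIntegral s (fun U ↦ F (translateOn s U (vΛ U))) V_k`; `R : Density P j G` = the integrated old
expression (the last two integrals of the display), fibre-independent by p. 194.

WHAT IS PROVED (all [folklore]; no `sorry`, no new axioms).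
§1 (generic: a `DecidableEq`-indexed family of measurable groups `X i` with measures `μ i`, Mathlib `lmarginal`):
   `lmarginal_comp_mul_right` — for right-invariant σ-finite `μ i`, `(∫⋯∫⁻_s, f(·*W) ∂μ) V = (∫⋯∫⁻_s, f ∂μ) (V*W)`
   (translating ALL variables by a fixed field `W` moves the base point); `lmarginal_comp_mul_left` (left twin);
   `mulOn` and `lmarginal_mulOn` — translating ONLY the fibre variables by a fixed field leaves the fibre integral
   unchanged at the same base point; `IndepField`, `lmarginal_mulOn_of_indepField` — the same when the translating
   field is a functional of the variables NOT integrated (the (1.100) change of variables, generic form).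
§2 (over the tree's `Setup` carrier; `HaarData.map_mul_right`/`map_mul_left` registered as the Mathlib instances
   `IsMulRightInvariant`/`IsMulLeftInvariant` of `HaarData.haar`; `[MeasurableMul G]`, which every `[MeasurableMul₂ G]`
   carrier of the T4 modules supplies): `translate`, `translateOn`, `FieldIndep` (with `FieldIndep.const/inv/mul`),
   `translateOn_translateOn_inv` / `translateOn_inv_translateOn` (C13: `(V·_sW⁻¹)·_sW = V`, i.e. `V′_kV_{Λ_i} = V_k`),
   `fibreIntegral_translate` (row item (k1)), `fibreIntegral_translateOn`, `fibreIntegral_translateOn_of_fieldIndep` (row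
   item (k3) = C14: the printed `dV′⌈_{Λ_i}`-denominator equals `fibreIntegral s F V`, the literal-domain fibre integral of
   the numerator-as-a-function-of-`V_k`) and its printed-orientation twin `fibreIntegral_translateOn_inv_of_fieldIndep`
   (row item (k4): translation by `(V_{Λ_i})⁻¹`), `fibreIntegral_of_fibreIndep` (`∫⌈_s R = R` for `R ≥ 0` fibre-independent
   — p. 194), `div_mul_eq_normTerm`, `term1100_eq_normTerm` (the `i`-th quotient of (1.100) times `R` IS `normTerm s F R`
   pointwise) and `integral_term1100_eq` ((1.102) for that ONE component term in the PRINTED variables: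
   `∫dV_k [F(V_k)/∫dV′⌈_{Λ_i}F((V′V_{Λ_i}) ∪ V_k⌈_{Λ_iᶜ})]·R(V_k) = ∫dV_k R(V_k)` for measurable, nonnegative, bounded `F`,
   `R`, `R` fibre-independent, and a nowhere-vanishing denominator — the printed proviso of p. 176, census row G-B15-01 —
   obtained from `B15.BasicStep.integral_normTerm_eq` by name; sums over terms and products over DISJOINT components are
   `B15.BasicStep.integral_ropReal_eq` / `T4JointDressing.fibreIntegral_union_mul_eq`, not redone).  Base-point
   independence of `fibreIntegral s f` in the `s`-coordinates (row item (k2)) is `B15.BasicStep.indepOf_lmarginal`, not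
   restated.

NOT TYPED here (located, recorded in `t4/T4-XREAD-U5X15.md` / cell GAPS): (a) `δ_{G_i}(V′)` is a δ-function of the axial
gauge on the tree graph `G_i` — for non-discrete `G` a measure carried by a Haar-null subgroup of `G^{Λ_i}` — so it is NOT
a bounded density `F`: the bounded-density model of `B15.BasicStep`/`T4DressedR`/this file covers `χ(Λ_i)·exp[−g_k^{−2}A(…)]` and
any bounded insertion, and covers the printed term only after the gauge-fixing δ-functions are removed by the «reversed
Faddeev–Popov procedure» of [V] p. 378 (under the `dV_k⌈_{X_i}`-integral; cross-read X-16) or replaced by a bounded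
Faddeev–Popov insertion — exactly as for (0.3) in `B15.BasicStep`; (b) the factorisation of the joint `Λ = ∪_iΛ_i`
integral over the components («The integrations in (1.99) are also factorized in those components», p. 201) is
`T4JointDressing.fibreIntegral_union_mul_eq`, not redone; (c) positivity of the denominators is announced on p. 176 and
not returned to in [IV] (GAPS G-B15-01) — it is the hypothesis `hden` below; (d) nothing about `V_Λ` itself
(existence/uniqueness of the minimiser, (1.78), (1.83), measurability in `V_k`) is typed — `FieldIndep s vΛ` is a
hypothesis shape; in the application `vΛ` must moreover be measurable for `U ↦ F(translateOn s U (vΛ U))` to be a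
measurable density, which `integral_term1100_eq` does not need (its denominator is rewritten to `fibreIntegral s F`
before any integration in `V_k`).
-/

open scoped BigOperators ENNReal
open _root_.MeasureTheory Function Finset

namespace Literature.MathematicalPhysics.QuantumFieldTheory.Balaban1983to89.T4FibreTranslate

open B15.BasicStep T4DressedR

/-! ## §1 Generic fibre level: translations of a finite product of invariant measures under `lmarginal` -/

section Fibre

variable {ι : Type*} [DecidableEq ι] {X : ι → Type*} [∀ i, MeasurableSpace (X i)] (μ : ∀ i, Measure (X i))
  [∀ i, Group (X i)] [∀ i, MeasurableMul (X i)] [∀ i, SigmaFinite (μ i)]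

/-- RIGHT TRANSLATION OF ALL VARIABLES by a fixed field `W` commutes with the fibre integral up to moving the base point:
`∫dV⌈_s [f(·W)](V) = (∫dV⌈_s f)(VW)` (right invariance of the finite product `∏_{i∈s} μ_i` of right-invariant measures,
Mathlib `Measure.pi.isMulRightInvariant` + `lintegral_mul_right_eq_self`). [folklore] -/
theorem lmarginal_comp_mul_right [∀ i, (μ i).IsMulRightInvariant] (s : Finset ι) (f : (∀ i, X i) → ℝ≥0∞)
    (W V : ∀ i, X i) :
    (∫⋯∫⁻_s, (fun U => f (U * W)) ∂μ) V = (∫⋯∫⁻_s, f ∂μ) (V * W) := by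
  simp only [lmarginal]
  have h : ∀ y : ∀ i : s, X i, updateFinset V s y * W = updateFinset (V * W) s (y * fun i : ↥s => W (i : ι)) := by
    intro y; funext i
    by_cases hi : i ∈ s
    · simp only [Pi.mul_apply, updateFinset, dif_pos hi]
    · simp only [Pi.mul_apply, updateFinset, dif_neg hi]
  simp_rw [h]
  exact lintegral_mul_right_eq_self (μ := Measure.pi fun i : s => μ i)
    (fun y => f (updateFinset (V * W) s y)) (fun i => W i)

/-- LEFT twin: `∫dV⌈_s [f(W·)](V) = (∫dV⌈_s f)(WV)` for left-invariant fibre measures. [folklore] -/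
theorem lmarginal_comp_mul_left [∀ i, (μ i).IsMulLeftInvariant] (s : Finset ι) (f : (∀ i, X i) → ℝ≥0∞)
    (W V : ∀ i, X i) :
    (∫⋯∫⁻_s, (fun U => f (W * U)) ∂μ) V = (∫⋯∫⁻_s, f ∂μ) (W * V) := by
  simp only [lmarginal]
  have h : ∀ y : ∀ i : s, X i, W * updateFinset V s y = updateFinset (W * V) s ((fun i : ↥s => W (i : ι)) * y) := by
    intro y; funext i
    by_cases hi : i ∈ s
    · simp only [Pi.mul_apply, updateFinset, dif_pos hi]
    · simp only [Pi.mul_apply, updateFinset, dif_neg hi]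
  simp_rw [h]
  exact lintegral_mul_left_eq_self (μ := Measure.pi fun i : s => μ i)
    (fun y => f (updateFinset (W * V) s y)) (fun i => W i)

/-- `mulOn s U W`: the field `U` right-multiplied by `W` on the coordinates of `s` ONLY (`U_i W_i` for `i ∈ s`, `U_i`
otherwise) — the shape of `V′ ↦ V′V_{Λ_i}` on the `Λ_i`-variables with the remaining variables `V_k⌈_{Λ_iᶜ}` untouched.
[cite: Balaban1989LargeFieldI, (1.100) p.201] -/
def mulOn (s : Finset ι) (U W : ∀ i, X i) : ∀ i, X i := fun i => if i ∈ s then U i * W i else U i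

omit [∀ i, MeasurableSpace (X i)] [∀ i, MeasurableMul (X i)] in
/-- On an updated field, `mulOn s` only changes the inserted fibre coordinates. [folklore] -/
theorem mulOn_updateFinset (s : Finset ι) (V W : ∀ i, X i) (y : ∀ i : s, X i) :
    mulOn s (updateFinset V s y) W = updateFinset V s (y * fun i : ↥s => W (i : ι)) := by
  funext i
  by_cases hi : i ∈ s
  · simp only [mulOn, if_pos hi, updateFinset, dif_pos hi, Pi.mul_apply]
  · simp only [mulOn, if_neg hi, updateFinset, dif_neg hi]

/-- TRANSLATING ONLY THE FIBRE VARIABLES by a fixed field leaves the fibre integral unchanged AT THE SAME BASE POINT: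
`∫dV⌈_s [f(· ·_s W)](V) = (∫dV⌈_s f)(V)`. [folklore] -/
theorem lmarginal_mulOn [∀ i, (μ i).IsMulRightInvariant] (s : Finset ι) (f : (∀ i, X i) → ℝ≥0∞)
    (W V : ∀ i, X i) :
    (∫⋯∫⁻_s, (fun U => f (mulOn s U W)) ∂μ) V = (∫⋯∫⁻_s, f ∂μ) V := by
  simp only [lmarginal]
  simp_rw [mulOn_updateFinset]
  exact lintegral_mul_right_eq_self (μ := Measure.pi fun i : s => μ i)
    (fun y => f (updateFinset V s y)) (fun i => W i)

/-- `IndepField s g`: the FIELD-valued functional `g` does not depend on the variables indexed by `s` (the shape of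
`V_k ↦ V_Λ`: p. 194 «a minimum of the Wilson action … on the domain of integration», hence a functional of the variables
off `Λ`; the field-valued twin of `B15.BasicStep.IndepOf`). [cite: Balaban1989LargeFieldI, p.194] -/
def IndepField (s : Finset ι) (g : (∀ i, X i) → (∀ i, X i)) : Prop :=
  ∀ (x : ∀ i, X i) (y : ∀ i : s, X i), g (updateFinset x s y) = g x

/-- THE (1.100) CHANGE OF VARIABLES, generic form: if the translating field `g U` does not depend on the integrated
variables, then `∫dV⌈_s [f(U ·_s g(U))](V) = (∫dV⌈_s f)(V)` — the `dV′⌈_{Λ_i}`-integral of an expression in `V′V_{Λ_i}`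
equals the `dV_k⌈_{Λ_i}`-integral of the same expression in `V_k`. [cite: Balaban1989LargeFieldI, (1.100) p.201] -/
theorem lmarginal_mulOn_of_indepField [∀ i, (μ i).IsMulRightInvariant] (s : Finset ι)
    {g : (∀ i, X i) → (∀ i, X i)} (hg : IndepField s g) (f : (∀ i, X i) → ℝ≥0∞) (V : ∀ i, X i) :
    (∫⋯∫⁻_s, (fun U => f (mulOn s U (g U))) ∂μ) V = (∫⋯∫⁻_s, f ∂μ) V := by
  simp only [lmarginal]
  simp_rw [hg V, mulOn_updateFinset]
  exact lintegral_mul_right_eq_self (μ := Measure.pi fun i : s => μ i)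
    (fun y => f (updateFinset V s y)) (fun i => g V i)

end Fibre

/-! ## §2 Over the tree's `Setup` carrier (`fieldMeasure` = product of the normalized Haar measures; real densities) -/

section SetupLevel

variable {P : Params} {j : ℕ} {G : Type*} [GaugeGroup G] [MeasurableSpace G] [HaarData G]

/-- The Haar datum of `Setup` is right invariant (its field `map_mul_right`, as the Mathlib instance). [folklore] -/
instance haar_isMulRightInvariant : (HaarData.haar : Measure G).IsMulRightInvariant := ⟨HaarData.map_mul_right⟩

/-- The Haar datum of `Setup` is left invariant (its field `map_mul_left`, as the Mathlib instance). [folklore] -/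
instance haar_isMulLeftInvariant : (HaarData.haar : Measure G).IsMulLeftInvariant := ⟨HaarData.map_mul_left⟩

/-- Bondwise right translation `(U·W)(b) = U(b)W(b)` of a gauge field by a field. [folklore] -/
def translate (U W : GaugeField P j G) : GaugeField P j G := fun b => U b * W b

variable [DecidableEq (PBond P j)]

/-- Bondwise right translation ON THE BONDS OF `s` ONLY: `U(b)W(b)` for `b ∈ s`, `U(b)` otherwise — the field
`(V′V_{Λ_i}) ∪ V_k⌈_{Λ_iᶜ}` of the denominator of (1.100) as a function of `(V′ ∪ V_k⌈_{Λ_iᶜ}, V_{Λ_i})`.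
[cite: Balaban1989LargeFieldI, (1.100) p.201] -/
def translateOn (s : Finset (PBond P j)) (U W : GaugeField P j G) : GaugeField P j G :=
  fun b => if b ∈ s then U b * W b else U b

/-- `FieldIndep s vΛ`: the field-valued functional `vΛ` of the gauge field does not depend on the bond variables of `s` —
the HYPOTHESIS SHAPE of Bałaban's `V_Λ = M^k(U₀)` (p. 197), `U₀` the minimiser over the `Λ`-variables (p. 194); nothing is
asserted about that minimiser. [cite: Balaban1989LargeFieldI, p.197] -/
def FieldIndep (s : Finset (PBond P j)) (vΛ : GaugeField P j G → GaugeField P j G) : Prop :=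
  ∀ (x : GaugeField P j G) (y : s → G), vΛ (updateFinset x s y) = vΛ x

omit [GaugeGroup G] [MeasurableSpace G] [HaarData G] in
/-- A constant field is fibre-independent. [folklore] -/
theorem FieldIndep.const (s : Finset (PBond P j)) (W : GaugeField P j G) : FieldIndep s (fun _ => W) :=
  fun _ _ => rfl

omit [MeasurableSpace G] [HaarData G] in
/-- The bondwise inverse of a fibre-independent field functional is fibre-independent (`V_Λ ↦ V_Λ⁻¹`). [folklore] -/
theorem FieldIndep.inv {s : Finset (PBond P j)} {vΛ : GaugeField P j G → GaugeField P j G} (h : FieldIndep s vΛ) :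
    FieldIndep s (fun U b => (vΛ U b)⁻¹) := by
  intro x y
  funext b
  simp only [h x y]

omit [MeasurableSpace G] [HaarData G] in
/-- Bondwise products of fibre-independent field functionals are fibre-independent. [folklore] -/
theorem FieldIndep.mul {s : Finset (PBond P j)} {v w : GaugeField P j G → GaugeField P j G} (hv : FieldIndep s v)
    (hw : FieldIndep s w) : FieldIndep s (fun U b => v U b * w U b) := by
  intro x y
  funext b
  simp only [hv x y, hw x y]

omit [MeasurableSpace G] [HaarData G] in
/-- C13 of the census: `V′_kV_{Λ_i} = V_k` for `V′_k = V_k(V_{Λ_i})⁻¹` — translating on `s` by `W⁻¹` and then by `W` is the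
identity. [cite: Balaban1989LargeFieldII, p.378] -/
theorem translateOn_translateOn_inv (s : Finset (PBond P j)) (V W : GaugeField P j G) :
    translateOn s (translateOn s V (fun b => (W b)⁻¹)) W = V := by
  funext b
  by_cases hb : b ∈ s
  · simp only [translateOn, if_pos hb, inv_mul_cancel_right]
  · simp only [translateOn, if_neg hb]

omit [MeasurableSpace G] [HaarData G] in
/-- … and in the other order. [folklore] -/
theorem translateOn_inv_translateOn (s : Finset (PBond P j)) (V W : GaugeField P j G) :
    translateOn s (translateOn s V W) (fun b => (W b)⁻¹) = V := by
  funext b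
  by_cases hb : b ∈ s
  · simp only [translateOn, if_pos hb, mul_inv_cancel_right]
  · simp only [translateOn, if_neg hb]

variable [MeasurableMul G]

/-- (k1) RIGHT TRANSLATION OF THE WHOLE FIELD commutes with the real fibre integral up to moving the base point:
`∫dV⌈_s [f(·W)](V) = (∫dV⌈_s f)(VW)`. [folklore] -/
theorem fibreIntegral_translate (s : Finset (PBond P j)) (f : Density P j G) (W V : GaugeField P j G) :
    fibreIntegral s (fun U => f (translate U W)) V = fibreIntegral s f (translate V W) := by
  unfold fibreIntegral
  congr 1
  exact lmarginal_comp_mul_right (fun _ : PBond P j => (HaarData.haar : Measure G)) s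
    (fun U => ENNReal.ofReal (f U)) W V

/-- Translating only the `s`-variables by a FIXED field leaves the real fibre integral unchanged at the same base point.
[folklore] -/
theorem fibreIntegral_translateOn (s : Finset (PBond P j)) (f : Density P j G) (W V : GaugeField P j G) :
    fibreIntegral s (fun U => f (translateOn s U W)) V = fibreIntegral s f V := by
  unfold fibreIntegral
  congr 1
  exact lmarginal_mulOn (fun _ : PBond P j => (HaarData.haar : Measure G)) s
    (fun U => ENNReal.ofReal (f U)) W V

/-- (k3) = C14 of the census, THE (1.100) CHANGE OF VARIABLES over `Setup`: for a translating field `vΛ` independent of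
the `Λ_i`-variables, `∫dV′⌈_{Λ_i} F((V′·vΛ) ∪ V_k⌈_{Λ_iᶜ}) = ∫dV_k⌈_{Λ_i} F(V_k)` — the printed `dV′`-denominator is the
fibre integral of the numerator-as-a-function-of-`V_k` over the LITERAL `Λ_i`-variables (right invariance of the
normalized Haar measures, p. 176). [cite: Balaban1989LargeFieldI, (1.100) p.201] -/
theorem fibreIntegral_translateOn_of_fieldIndep (s : Finset (PBond P j)) {vΛ : GaugeField P j G → GaugeField P j G}
    (hv : FieldIndep s vΛ) (F : Density P j G) (V : GaugeField P j G) :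
    fibreIntegral s (fun U => F (translateOn s U (vΛ U))) V = fibreIntegral s F V := by
  unfold fibreIntegral
  congr 1
  exact lmarginal_mulOn_of_indepField (fun _ : PBond P j => (HaarData.haar : Measure G)) s hv
    (fun U => ENNReal.ofReal (F U)) V

omit [MeasurableMul G] in
/-- A nonnegative density independent of the `s`-variables is its own fibre integral over the normalized Haar fibres
(p. 194: the integrated expression is «independent of V_k⌈_Λ»). [cite: Balaban1989LargeFieldI, p.194] -/
theorem fibreIntegral_of_fibreIndep (s : Finset (PBond P j)) {R : Density P j G} (hR : FibreIndep s R)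
    (hR0 : ∀ V, 0 ≤ R V) (V : GaugeField P j G) : fibreIntegral s R V = R V := by
  unfold fibreIntegral
  have h : (∫⋯∫⁻_s, (fun U => ENNReal.ofReal (R U)) ∂(fun _ : PBond P j => (HaarData.haar : Measure G)))
      = fun U => ENNReal.ofReal (R U) :=
    lmarginal_of_indepOf s (fun x y => by simp only [hR x y])
  rw [h, ENNReal.toReal_ofReal (hR0 V)]

omit [MeasurableMul G] in
/-- For `R ≥ 0` independent of the `s`-variables, `[F(V)/∫dV⌈_s F(V)]·R(V) = normTerm s F R (V)` (`normTerm s F R V =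
F V · (∫⌈_s R / ∫⌈_s F)(V)` and `∫⌈_s R = R`). [folklore] -/
theorem div_mul_eq_normTerm (s : Finset (PBond P j)) (F R : Density P j G) (hR : FibreIndep s R)
    (hR0 : ∀ V, 0 ≤ R V) (V : GaugeField P j G) :
    F V / fibreIntegral s F V * R V = normTerm s F R V := by
  simp only [normTerm, fibreIntegral_of_fibreIndep s hR hR0 V]
  ring

/-- THE `i`-TH QUOTIENT OF (1.100) IS ONE `normTerm`: with `F` = the numerator read as a function of `V_k`, `vΛ` the
translating field (independent of the `Λ_i`-variables) and `R ≥ 0` the integrated old expression (independent of the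
`Λ_i`-variables), `[F(V_k) / ∫dV′⌈_{Λ_i}F((V′·vΛ) ∪ V_k⌈_{Λ_iᶜ})]·R(V_k) = normTerm Λ_i F R (V_k)` pointwise.
[cite: Balaban1989LargeFieldI, (1.100) p.201] -/
theorem term1100_eq_normTerm (s : Finset (PBond P j)) {vΛ : GaugeField P j G → GaugeField P j G}
    (hv : FieldIndep s vΛ) (F R : Density P j G) (hR : FibreIndep s R) (hR0 : ∀ V, 0 ≤ R V) (V : GaugeField P j G) :
    F V / fibreIntegral s (fun U => F (translateOn s U (vΛ U))) V * R V = normTerm s F R V := by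
  rw [fibreIntegral_translateOn_of_fieldIndep s hv F V]
  exact div_mul_eq_normTerm s F R hR hR0 V

/-- (1.102) FOR ONE COMPONENT TERM IN THE PRINTED VARIABLES: if the numerator-as-a-function-of-`V_k` `F` and the
integrated expression `R` are measurable, nonnegative and bounded, `R` does not depend on the `Λ_i`-variables, and the
denominator vanishes nowhere (the proviso of p. 176, GAPS G-B15-01), then
`∫dV_k [F(V_k)/∫dV′⌈_{Λ_i}F((V′·vΛ(V_k)) ∪ V_k⌈_{Λ_iᶜ})]·R(V_k) = ∫dV_k R(V_k)` — by `B15.BasicStep.integral_normTerm_eq`.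
[cite: Balaban1989LargeFieldI, (1.102) p.201] -/
theorem integral_term1100_eq (s : Finset (PBond P j)) {vΛ : GaugeField P j G → GaugeField P j G}
    (hv : FieldIndep s vΛ) {F R : Density P j G} (hFm : Measurable F) (hRm : Measurable R) (hF0 : ∀ V, 0 ≤ F V)
    (hR0 : ∀ V, 0 ≤ R V) {C : ℝ} (hFC : ∀ V, F V ≤ C) (hRC : ∀ V, R V ≤ C) (hR : FibreIndep s R)
    (hden : ∀ V, fibreIntegral s (fun U => F (translateOn s U (vΛ U))) V ≠ 0) :
    ∫ V, F V / fibreIntegral s (fun U => F (translateOn s U (vΛ U))) V * R V ∂(fieldMeasure P j G)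
      = ∫ V, R V ∂(fieldMeasure P j G) := by
  have hden' : ∀ V, fibreIntegral s F V ≠ 0 := fun V => by
    rw [← fibreIntegral_translateOn_of_fieldIndep s hv F V]; exact hden V
  have hpt : (fun V => F V / fibreIntegral s (fun U => F (translateOn s U (vΛ U))) V * R V) = normTerm s F R :=
    funext (term1100_eq_normTerm s hv F R hR hR0)
  rw [hpt]
  exact integral_normTerm_eq s hFm hRm hF0 hR0 hFC hRC hden'

/-- The same with the translating field entering through its INVERSE, as printed (`V′_k = V_k(V_{Λ_i})⁻¹`, so the
denominator's integrand is the numerator at `V′V_{Λ_i}`): for `vΛ` fibre-independent, the denominator written with the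
change of variables `U ↦ U ·_s (vΛ U)⁻¹` also equals `fibreIntegral s F`. [cite: Balaban1989LargeFieldII, p.378] -/
theorem fibreIntegral_translateOn_inv_of_fieldIndep (s : Finset (PBond P j))
    {vΛ : GaugeField P j G → GaugeField P j G} (hv : FieldIndep s vΛ) (F : Density P j G) (V : GaugeField P j G) :
    fibreIntegral s (fun U => F (translateOn s U (fun b => (vΛ U b)⁻¹))) V = fibreIntegral s F V :=
  fibreIntegral_translateOn_of_fieldIndep s hv.inv F V

end SetupLevel

end Literature.MathematicalPhysics.QuantumFieldTheory.Balaban1983to89.T4FibreTranslate
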